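import Mathlib
import HarnessLib
import Summits.Ventures.LatticeQCDFlow.Exactness.TransformedKernel
import Summits.Ventures.LatticeQCDFlow.Exactness.CheckerboardSweep
import Summits.Ventures.LatticeQCDFlow.Exactness.SphereKickJacobian
import Summits.Ventures.LatticeQCDFlow.Exactness.SphereKickSweep

/-!
# The nearest-neighbour local field with link transporters: the pre-registered map constant `|c| · (degree) ≤ 1` puts every site update in the bijectivity range, so THMC with the Engel–Schaefer sweep is exact with no further hypothesis

HONEST FRAMING: exact (Metropolis-corrected) sampling algorithms for lattice gauge theory;
figures of merit are autocorrelation/cost numbers at stated couplings and volumes; no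
continuum-physics claim.

Venture `LatticeQCDFlow` (cell pub-lqcd), topic `Exactness`; FANOUT row 7 (`s0-cpn-null`: the
S0-D1 rung — 2D CP⁹, Lüscher's LO trivializing map inside HMC, Engel–Schaefer 2011).  NEW WORK of
the cell: the CONCRETE local field of the rung's algorithm fed to `Exactness/SphereKickSweep.lean`
(`SiteLocalField`, `kickSweepEquiv`, `kickSweep_thmc_invariant/_isReversible`).  Nothing is cited
as a fact.  Printed counterpart, NAMED ONLY: Engel–Schaefer, Comput. Phys. Commun. 182 (2011)
2107, §3 eqs. (15)–(17): in the auxiliary-U(1) form of the CP(N−1) action the local field at a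
site is the link-transported sum of its `2d` neighbours (times `Nβ`, absorbed into the step
constant `c = ε_s c_map Nβ` here), and the site update folds unless `ε_s c |J| ≤ 1` (the cell's
pre-registered map constant; `KickAngleMap.lean`, CANARY-C8).

## Content (site space `S(V)`, `dim V = n + 2`; active class `p`; for each active site `a` a
finite set `nbrs a` of FROZEN neighbours and link transporters `U a b : V →ₗᵢ V` — for CP(N−1)
the U(1) phases `λ_{x,μ}` acting on `ℂ^N ≅ ℝ^{2N}`, held fixed during the site sweep)

* `nnLocalField nbrs U a y = Σ_{b ∈ nbrs a} U a b (y b)` — continuous in the frozen configuration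
  (`continuous_nnLocalField`) and bounded by the degree: `‖J‖ ≤ #(nbrs a)` (`norm_nnLocalField_le`:
  unit neighbours, isometric transport).
* **`nnSiteLocalField`** — if every active site has at most `k` neighbours and `|c| k ≤ 1`, the
  nearest-neighbour field is a `SiteLocalField` (every update in the bijectivity range, for EVERY
  configuration): the map-constant criterion, typed.
* **`nnSweep_thmc_invariant`** / **`nnSweep_thmc_isReversible`** — hence THMC with the E–S
  checkerboard sweep built from two such fields (classes `p`, `q`; degree bounds `k₁`, `k₂` with
  `|c| kᵢ ≤ 1`) leaves every configuration weight `P · ⊗_ι μ.toSphere` invariant and inherits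
  detailed balance — with NO hypothesis on the configuration (`SphereKickSweep.kickSweep_thmc_*`).

NOT CLAIMED: that the classes are a checkerboard of an actual lattice (any finite `nbrs` into the
frozen class is allowed — for nearest neighbours on a bipartite lattice this is automatic), the
U(1) link update itself (links are parameters `U` here), the value of the map constant used in the
rung (a number; not restated), anything quantitative about autocorrelations.
-/

noncomputable section

namespace Summit.Ventures.LatticeQCDFlow.Exactness

open Real Set MeasureTheory Measure InnerProductGeometry Metric ProbabilityTheory
  ProbabilityTheory.Kernel Summit.Ventures.LatticeQCDFlow.Theory2
open scoped ENNReal InnerProductSpace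

/-! ## §1 The nearest-neighbour local field -/

section Field

variable {V : Type*} [NormedAddCommGroup V] [InnerProductSpace ℝ V] {ι : Type*} {p : ι → Prop}

/-- **The nearest-neighbour local field with link transporters**: at the active site `a`, the sum
over its frozen neighbours `b ∈ nbrs a` of the neighbour's site variable transported by the link
isometry `U a b` (E–S: `J_x = Σ_μ (λ̄_{x,μ} z_{x+μ̂} + λ_{x−μ̂,μ} z_{x−μ̂})`, up to the factor
absorbed into the step constant). -/
def nnLocalField (nbrs : {i // p i} → Finset {i // ¬p i})
    (U : {i // p i} → {i // ¬p i} → (V →ₗᵢ[ℝ] V)) (a : {i // p i})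
    (y : {i // ¬p i} → sphere (0 : V) 1) : V :=
  ∑ b ∈ nbrs a, U a b (y b)

/-- The nearest-neighbour field depends continuously on the frozen configuration. -/
theorem continuous_nnLocalField (nbrs : {i // p i} → Finset {i // ¬p i})
    (U : {i // p i} → {i // ¬p i} → (V →ₗᵢ[ℝ] V)) (a : {i // p i}) :
    Continuous (nnLocalField nbrs U a) := by
  unfold nnLocalField
  exact continuous_finsetSum _ fun b _ =>
    (U a b).continuous.comp (continuous_subtype_val.comp (continuous_apply b))

/-- **The field is bounded by the degree**: `‖J a y‖ ≤ #(nbrs a)` (each neighbour is a unit vector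
and the transporters are isometries). -/
theorem norm_nnLocalField_le (nbrs : {i // p i} → Finset {i // ¬p i})
    (U : {i // p i} → {i // ¬p i} → (V →ₗᵢ[ℝ] V)) (a : {i // p i})
    (y : {i // ¬p i} → sphere (0 : V) 1) :
    ‖nnLocalField nbrs U a y‖ ≤ (nbrs a).card := by
  unfold nnLocalField
  calc ‖∑ b ∈ nbrs a, U a b (y b)‖ ≤ ∑ b ∈ nbrs a, ‖U a b (y b)‖ := norm_sum_le _ _
    _ = ∑ b ∈ nbrs a, (1 : ℝ) := Finset.sum_congr rfl fun b _ => by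
        rw [LinearIsometry.norm_map, norm_eq_of_mem_sphere]
    _ = (nbrs a).card := by simp

/-- **The map-constant criterion, typed.**  If every active site has at most `k` (frozen)
neighbours and the step constant satisfies `|c| k ≤ 1`, then `|c| ‖J a y‖ ≤ 1` for EVERY
configuration: the nearest-neighbour field is a `SiteLocalField`, i.e. every single-site update of
the sweep lies in the bijectivity range of `KickAngleMap.lean`. -/
def nnSiteLocalField (c : ℝ) (nbrs : {i // p i} → Finset {i // ¬p i})
    (U : {i // p i} → {i // ¬p i} → (V →ₗᵢ[ℝ] V)) (k : ℕ) (hdeg : ∀ a, (nbrs a).card ≤ k)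
    (hc : |c| * k ≤ 1) : SiteLocalField V c p where
  J := nnLocalField nbrs U
  continuous := continuous_nnLocalField nbrs U
  norm_le a y :=
    calc |c| * ‖nnLocalField nbrs U a y‖ ≤ |c| * k :=
        mul_le_mul_of_nonneg_left
          ((norm_nnLocalField_le nbrs U a y).trans (Nat.cast_le.2 (hdeg a))) (abs_nonneg c)
      _ ≤ 1 := hc

/-- The field of `nnSiteLocalField` is the nearest-neighbour field. -/
@[simp] theorem nnSiteLocalField_J (c : ℝ) (nbrs : {i // p i} → Finset {i // ¬p i})
    (U : {i // p i} → {i // ¬p i} → (V →ₗᵢ[ℝ] V)) (k : ℕ) (hdeg : ∀ a, (nbrs a).card ≤ k)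
    (hc : |c| * k ≤ 1) : (nnSiteLocalField c nbrs U k hdeg hc).J = nnLocalField nbrs U := rfl

end Field

/-! ## §2 THMC with the nearest-neighbour sweep is exact, unconditionally in the configuration -/

section Sweep

variable (n : ℕ) {V : Type*} [NormedAddCommGroup V] [InnerProductSpace ℝ V] [FiniteDimensional ℝ V]
  [MeasurableSpace V] [BorelSpace V] (hV : Module.finrank ℝ V = n + 2) (c : ℝ)
  {ι : Type*} [Fintype ι] {p q : ι → Prop} [DecidablePred p] [DecidablePred q]
  (nbrs₁ : {i // p i} → Finset {i // ¬p i}) (U₁ : {i // p i} → {i // ¬p i} → (V →ₗᵢ[ℝ] V))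
  (nbrs₂ : {i // q i} → Finset {i // ¬q i}) (U₂ : {i // q i} → {i // ¬q i} → (V →ₗᵢ[ℝ] V))
  {k₁ k₂ : ℕ} (hdeg₁ : ∀ a, (nbrs₁ a).card ≤ k₁) (hdeg₂ : ∀ a, (nbrs₂ a).card ≤ k₂)
  (hc₁ : |c| * k₁ ≤ 1) (hc₂ : |c| * k₂ ≤ 1)

/-- **THMC with the nearest-neighbour Engel–Schaefer sweep is exact (invariance).**  Site space the
unit sphere of `V` (`dim V = n + 2`), reference measure `⊗_ι μ.toSphere`, two classes `p`, `q` with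
nearest-neighbour fields of degree at most `k₁`, `k₂` transported by fixed link isometries, and a
step constant with `|c| k₁ ≤ 1`, `|c| k₂ ≤ 1`.  Then for every measurable configuration weight
`P ≥ 0`, any update of the pulled-back variables leaving `(P ∘ F) · sweepJac · ⊗ μ.toSphere`
invariant, reported through the sweep `F`, leaves `P · ⊗ μ.toSphere` invariant — for ALL
configurations, the bijectivity range being guaranteed by the map constant alone. -/
theorem nnSweep_thmc_invariant (μ : Measure V) [μ.IsAddHaarMeasure]
    {P : (ι → sphere (0 : V) 1) → ℝ≥0∞} (hP : Measurable P)
    {κ : Kernel (ι → sphere (0 : V) 1) (ι → sphere (0 : V) 1)}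
    (hκ : Invariant κ ((Measure.pi fun _ : ι => μ.toSphere).withDensity fun W =>
      P (kickSweepEquiv n hV c (nnSiteLocalField c nbrs₁ U₁ k₁ hdeg₁ hc₁)
          (nnSiteLocalField c nbrs₂ U₂ k₂ hdeg₂ hc₂) W) *
        ENNReal.ofReal (sweepJac p q (fun a y g => sphereKick c (nnLocalField nbrs₁ U₁ a y) g)
          (classJac n c (nnSiteLocalField c nbrs₁ U₁ k₁ hdeg₁ hc₁))
          (classJac n c (nnSiteLocalField c nbrs₂ U₂ k₂ hdeg₂ hc₂)) W))) :
    Invariant (conjKernel κ (kickSweepEquiv n hV c (nnSiteLocalField c nbrs₁ U₁ k₁ hdeg₁ hc₁)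
        (nnSiteLocalField c nbrs₂ U₂ k₂ hdeg₂ hc₂)))
      ((Measure.pi fun _ : ι => μ.toSphere).withDensity P) :=
  kickSweep_thmc_invariant n hV c _ _ μ hP hκ

/-- **THMC with the nearest-neighbour Engel–Schaefer sweep is exact (detailed balance).** -/
theorem nnSweep_thmc_isReversible (μ : Measure V) [μ.IsAddHaarMeasure]
    {P : (ι → sphere (0 : V) 1) → ℝ≥0∞} (hP : Measurable P)
    {κ : Kernel (ι → sphere (0 : V) 1) (ι → sphere (0 : V) 1)}
    (hκ : IsReversible κ ((Measure.pi fun _ : ι => μ.toSphere).withDensity fun W =>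
      P (kickSweepEquiv n hV c (nnSiteLocalField c nbrs₁ U₁ k₁ hdeg₁ hc₁)
          (nnSiteLocalField c nbrs₂ U₂ k₂ hdeg₂ hc₂) W) *
        ENNReal.ofReal (sweepJac p q (fun a y g => sphereKick c (nnLocalField nbrs₁ U₁ a y) g)
          (classJac n c (nnSiteLocalField c nbrs₁ U₁ k₁ hdeg₁ hc₁))
          (classJac n c (nnSiteLocalField c nbrs₂ U₂ k₂ hdeg₂ hc₂)) W))) :
    IsReversible (conjKernel κ (kickSweepEquiv n hV c (nnSiteLocalField c nbrs₁ U₁ k₁ hdeg₁ hc₁)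
        (nnSiteLocalField c nbrs₂ U₂ k₂ hdeg₂ hc₂)))
      ((Measure.pi fun _ : ι => μ.toSphere).withDensity P) :=
  kickSweep_thmc_isReversible n hV c _ _ μ hP hκ

/-- **The sweep's Jacobian for the nearest-neighbour field**, stated on its own: w.r.t.
`⊗_ι μ.toSphere` the E–S sweep has exact Jacobian `sweepJac` of the eq. (18) factors at the
nearest-neighbour local fields (`SphereKickSweep.hasJacobian_kickSweepEquiv`). -/
theorem hasJacobian_nnSweep (μ : Measure V) [μ.IsAddHaarMeasure] :
    HasJacobian (Measure.pi fun _ : ι => μ.toSphere)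
      (kickSweepEquiv n hV c (nnSiteLocalField c nbrs₁ U₁ k₁ hdeg₁ hc₁)
        (nnSiteLocalField c nbrs₂ U₂ k₂ hdeg₂ hc₂)) fun W =>
      ENNReal.ofReal (sweepJac p q (fun a y g => sphereKick c (nnLocalField nbrs₁ U₁ a y) g)
        (classJac n c (nnSiteLocalField c nbrs₁ U₁ k₁ hdeg₁ hc₁))
        (classJac n c (nnSiteLocalField c nbrs₂ U₂ k₂ hdeg₂ hc₂)) W) :=
  hasJacobian_kickSweepEquiv n hV c _ _ μ

end Sweep

end Summit.Ventures.LatticeQCDFlow.Exactness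

end
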